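import Literature.AlgebraicGeometry.GroupSchemes.CartierDualFiniteFlat
import Literature.AlgebraicGeometry.GroupSchemes.AffineGroupSchemeBialgHom
import Literature.RingTheory.HopfAlgebra.FiniteDualSubalgebra
import HarnessLib

/-!
# Functoriality of the Cartier dual: `f : G₁ → G₂` ↦ `f^D : G₂^D → G₁^D` (Tate 1997 §(3.8); Görtz–Wedhorn II §(27.2))

Layer `Literature/AlgebraicGeometry/GroupSchemes`, namespace `Literature.AlgebraicGeometry.GroupSchemes.AffineGroupScheme` (continues ★
`CartierDualFiniteFlat` p845244 — `DualAlg G = Γ(G, 𝒪_G)^*`, `cartierDual G = Spec (DualAlg G)`, `cartierDualGrpObj` — and ★ `AffineGroupSchemeBialgHom`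
— `Alg.comapBialgHom f : Γ(G₂) →ₐc[R] Γ(G₁)` for a homomorphism `f`, `isMonHom_specOverMapOfAlgHom`).  DEFINITIONS (`DualAlg.transpose f`, its
bialgebra form `DualAlg.transposeBialgHom f`, `cartierDualMap f`) + theorems; no instance, no notation, no named fact, no `sorry`.  Cell
`hodgecm-mathlib` (D-0151), programme P6 «MOD», HEART organ (g1) «scheme dress of Cartier duality», FILE 3 of the B-p04 (g37) plan.  Count-neutral
Mathlib-side capital: HC_CM is proved only modulo the 7 printed citations until rung 0 closes; nothing here bears on it.

THE PRINT ([Tate1997FiniteFlatGroupSchemes] §(3.8) pp. 145–146: «`G ↦ G^D` is a contravariant functor … the transposes of the structure maps»;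
[GortzWedhorn2023] §(27.2)).  For a homomorphism `f : G₁ ⟶ G₂` of finite free commutative group schemes over `R`, `Γ(f) : Γ(G₂) → Γ(G₁)` is a
bialgebra map (★ `Alg.comapBialgHom`), so its TRANSPOSE `Γ(G₁)^* → Γ(G₂)^*`, `φ ↦ φ ∘ Γ(f)`, is a bialgebra map of the dual Hopf algebras
(★ CD3-lin: transpose along a coalgebra map is an algebra map of the convolution algebras; ★ CD3-co `dualComul_comp_transpose`: transpose of an
algebra map is a coalgebra map of the dual coalgebras), and `f^D := Spec` of it is a homomorphism `G₂^D → G₁^D` (★ `isMonHom_specOverMapOfAlgHom`).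

* §1 **`DualAlg.transpose f : DualAlg G₁ →ₐ[R] DualAlg G₂`** (`transpose_apply_apply : transpose f φ a = φ (Γ(f) a)`), its counit ∕ comultiplication
  compatibilities and **`DualAlg.transposeBialgHom f : DualAlg G₁ →ₐc[R] DualAlg G₂`**; `transpose_id`, `transpose_comp`.
* §2 **`cartierDualMap f : cartierDual G₂ ⟶ cartierDual G₁`** (`:= Spec (transpose f)`), HEAD **`isMonHom_cartierDualMap`**, the points formula
  `coord_comp_cartierDualMap` (`coord (x ≫ f^D) = coord x ∘ transpose f` — a character is pulled back along `f`), and functoriality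
  `cartierDualMap_id`, `cartierDualMap_comp` (`(g ∘ f)^D = f^D ∘ g^D`).

NOT here (FILE 4): the bidual `(G^D)^D ≅ G`; base change; the kernel of `G^D → H^D` for a closed subgroup `H ↪ G` and its rank.

## References
* [Tate1997FiniteFlatGroupSchemes] J. Tate, *Finite flat group schemes*, in: Modular Forms and Fermat's Last Theorem (1997), §(3.8) pp. 144–146.
* [GortzWedhorn2023] U. Görtz, T. Wedhorn, *Algebraic Geometry II* (2023), §(27.2), (27.2.1), Def. 27.6 (pp. 606–607).
-/

set_option autoImplicit false

-- Mathlib's `Over`/`Scheme` APIs are stated across semireducible wrappers (as in the ★ `GroupSchemes/*` files).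
set_option backward.isDefEq.respectTransparency false

universe u

open CategoryTheory CategoryTheory.Limits AlgebraicGeometry MonoidalCategory CartesianMonoidalCategory TensorProduct WithConv

noncomputable section

namespace Literature.AlgebraicGeometry.GroupSchemes

namespace AffineGroupScheme

open scoped MonObj

open Literature.AlgebraicGeometry.Motives Literature.NumberTheory.DiophantineGeometry Literature.RingTheory.HopfAlgebra

variable {R : Type u} [CommRing R] {G₁ G₂ G₃ : SchemeOver R}
  [GrpObj G₁] [IsCommMonObj G₁] [IsAffine G₁.left] [GrpObj G₂] [IsCommMonObj G₂] [IsAffine G₂.left]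
  [GrpObj G₃] [IsCommMonObj G₃] [IsAffine G₃.left]

/-- `Algebra.TensorProduct.map g g` agrees with `TensorProduct.map` of the underlying linear maps (pure tensors).
[cite: Tate1997FiniteFlatGroupSchemes, §(3.8) p. 145] -/
private theorem algebraTensorProductMap_apply_eq {A B : Type u} [CommRing A] [Algebra R A] [CommRing B] [Algebra R B] (g : A →ₐ[R] B)
    (x : A ⊗[R] A) : Algebra.TensorProduct.map g g x = TensorProduct.map g.toLinearMap g.toLinearMap x := by
  induction x using TensorProduct.induction_on with
  | zero => simp
  | tmul a b => simp
  | add x y hx hy => rw [map_add, map_add, hx, hy]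

/-! ## §1 The transpose `Γ(G₁)^* → Γ(G₂)^*` of `Γ(f)` is a bialgebra map -/

section Transpose

variable (f : G₁ ⟶ G₂) [IsMonHom f]

/-- **The transpose `φ ↦ φ ∘ Γ(f)` of the bialgebra map `Γ(f) : Γ(G₂) → Γ(G₁)`**, as an ALGEBRA map of the dual (convolution) algebras
`Γ(G₁)^* → Γ(G₂)^*` — multiplicative because `Γ(f)` is a COALGEBRA map (Mathlib `LinearMap.convMul_comp_coalgHom_distrib`; ★ CD3-lin
`existsUnique_algHom_comp_coalgHom`). [cite: Tate1997FiniteFlatGroupSchemes, §(3.8) p. 145] -/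
def DualAlg.transpose : DualAlg G₁ →ₐ[R] DualAlg G₂ :=
  AlgHom.ofLinearMap
    (show WithConv (Module.Dual R (Alg G₁)) →ₗ[R] WithConv (Module.Dual R (Alg G₂)) from
      { toFun := fun φ => toConv (φ.ofConv ∘ₗ (Alg.comapBialgHom f : Alg G₂ →ₗc[R] Alg G₁).toLinearMap)
        map_add' := fun φ χ => by apply ofConv_injective; ext b; simp
        map_smul' := fun r φ => by apply ofConv_injective; ext b; simp })
    (by
      apply ofConv_injective
      exact convOne_comp_coalgHom (A := R) (Alg.comapBialgHom f : Alg G₂ →ₗc[R] Alg G₁))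
    (fun φ χ => convMul_comp_coalgHom (A := R) (Alg.comapBialgHom f : Alg G₂ →ₗc[R] Alg G₁) φ χ)

/-- `(transpose f φ)(a) = φ (Γ(f) a)`. [cite: Tate1997FiniteFlatGroupSchemes, §(3.8) p. 145] -/
theorem DualAlg.transpose_apply_apply (φ : DualAlg G₁) (a : Alg G₂) :
    WithConv.ofConv (DualAlg.transpose f φ) a = WithConv.ofConv φ (Alg.comap f a) := rfl

/-- `(transpose f φ).ofConv = φ.ofConv ∘ Γ(f)` as linear forms. [cite: Tate1997FiniteFlatGroupSchemes, §(3.8) p. 145] -/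
theorem DualAlg.ofConv_transpose (φ : DualAlg G₁) :
    (show WithConv (Module.Dual R (Alg G₂)) from DualAlg.transpose f φ).ofConv =
      (show WithConv (Module.Dual R (Alg G₁)) from φ).ofConv ∘ₗ (Alg.comap f).toLinearMap :=
  rfl

/-- **The transpose commutes with the dual counits**: `ε₂^* (φ ∘ Γ(f)) = φ (Γ(f) 1) = φ 1 = ε₁^* φ` (★ CD3-co `dualCounit_comp_transpose`).
[cite: Tate1997FiniteFlatGroupSchemes, §(3.8) pp. 145–146] -/
theorem DualAlg.counit_comp_transpose [Module.Free R (Alg G₁)] [Module.Finite R (Alg G₁)] [Module.Free R (Alg G₂)] [Module.Finite R (Alg G₂)] :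
    Coalgebra.counit (R := R) (A := DualAlg G₂) ∘ₗ (DualAlg.transpose f).toLinearMap = Coalgebra.counit (R := R) (A := DualAlg G₁) :=
  dualCounit_comp_transpose (φ := Alg.comap f) (ε := FiniteDual.counit R (Alg G₂)) (ε'' := FiniteDual.counit R (Alg G₁))
    FiniteDual.counit_apply FiniteDual.counit_apply (T := (DualAlg.transpose f).toLinearMap) (fun _ _ => rfl)

/-- **The transpose commutes with the dual comultiplications**: `m₂^* ∘ Γ(f)^* = (Γ(f)^* ⊗ Γ(f)^*) ∘ m₁^*` because `Γ(f)` is multiplicative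
(★ CD3-co `dualComul_comp_transpose`, finite free `Γ(G₂)`). [cite: Tate1997FiniteFlatGroupSchemes, §(3.8) pp. 145–146] -/
theorem DualAlg.comul_comp_transpose [Module.Free R (Alg G₁)] [Module.Finite R (Alg G₁)] [Module.Free R (Alg G₂)] [Module.Finite R (Alg G₂)] :
    Coalgebra.comul (R := R) (A := DualAlg G₂) ∘ₗ (DualAlg.transpose f).toLinearMap =
      TensorProduct.map (DualAlg.transpose f).toLinearMap (DualAlg.transpose f).toLinearMap ∘ₗ Coalgebra.comul (R := R) (A := DualAlg G₁) :=
  dualComul_comp_transpose (φ := Alg.comap f) (ev := FiniteDual.evalTwo R (Alg G₂)) (δ := FiniteDual.comul R (Alg G₂))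
    (ev'' := FiniteDual.evalTwo R (Alg G₁)) (δ'' := FiniteDual.comul R (Alg G₁)) FiniteDual.evalTwo_tmul FiniteDual.evalTwo_comul
    FiniteDual.evalTwo_tmul FiniteDual.evalTwo_comul (T := (DualAlg.transpose f).toLinearMap) (fun _ _ => rfl)

/-- **HEAD (algebra) — the transpose of `Γ(f)` is a map of BIALGEBRAS `Γ(G₁)^* → Γ(G₂)^*`** of the dual Hopf algebras.
[cite: Tate1997FiniteFlatGroupSchemes, §(3.8) pp. 145–146] -/
def DualAlg.transposeBialgHom [Module.Free R (Alg G₁)] [Module.Finite R (Alg G₁)] [Module.Free R (Alg G₂)] [Module.Finite R (Alg G₂)] :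
    DualAlg G₁ →ₐc[R] DualAlg G₂ :=
  BialgHom.ofAlgHom (DualAlg.transpose f)
    (AlgHom.toLinearMap_injective (DualAlg.counit_comp_transpose f))
    (AlgHom.toLinearMap_injective (LinearMap.ext fun φ => by
      rw [AlgHom.toLinearMap_apply, AlgHom.toLinearMap_apply, AlgHom.comp_apply, AlgHom.comp_apply, algebraTensorProductMap_apply_eq]
      exact (LinearMap.congr_fun (DualAlg.comul_comp_transpose f) φ).symm))

/-- `DualAlg.transposeBialgHom f` is `DualAlg.transpose f` as an algebra map. [cite: Tate1997FiniteFlatGroupSchemes, §(3.8) p. 145] -/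
theorem DualAlg.toAlgHom_transposeBialgHom [Module.Free R (Alg G₁)] [Module.Finite R (Alg G₁)] [Module.Free R (Alg G₂)]
    [Module.Finite R (Alg G₂)] : (DualAlg.transposeBialgHom f : DualAlg G₁ →ₐ[R] DualAlg G₂) = DualAlg.transpose f := rfl

omit [IsMonHom f] in
/-- **`transpose (𝟙 G) = id`.** [cite: Tate1997FiniteFlatGroupSchemes, §(3.8) p. 145] -/
theorem DualAlg.transpose_id : DualAlg.transpose (𝟙 G₁) = AlgHom.id R (DualAlg G₁) := by
  apply AlgHom.ext
  intro φ
  apply ofConv_injective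
  rw [DualAlg.ofConv_transpose, Alg.comap_id]
  rfl

/-- **`transpose (f ≫ g) = transpose g ∘ transpose f`** (contravariance is absorbed twice: `Γ(f ≫ g) = Γ(f) ∘ Γ(g)`).
[cite: Tate1997FiniteFlatGroupSchemes, §(3.8) p. 145] -/
theorem DualAlg.transpose_comp (g : G₂ ⟶ G₃) [IsMonHom g] :
    DualAlg.transpose (f ≫ g) = (DualAlg.transpose g).comp (DualAlg.transpose f) := by
  apply AlgHom.ext
  intro φ
  apply ofConv_injective
  rw [DualAlg.ofConv_transpose, Alg.comap_comp, AlgHom.comp_apply, DualAlg.ofConv_transpose, DualAlg.ofConv_transpose,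
    LinearMap.comp_assoc]
  rfl

end Transpose

/-! ## §2 `f^D : G₂^D → G₁^D` -/

section Map

variable (f : G₁ ⟶ G₂) [IsMonHom f]

/-- **The Cartier dual `f^D : G₂^D → G₁^D` of a homomorphism `f : G₁ → G₂`**: `Spec` of the transpose `Γ(G₁)^* → Γ(G₂)^*` of `Γ(f)`
(on characters: `χ ↦ χ ∘ f`). [cite: Tate1997FiniteFlatGroupSchemes, §(3.8) p. 145] -/
def cartierDualMap : cartierDual G₂ ⟶ cartierDual G₁ := AlgPoints.specOverMapOfAlgHom (DualAlg.transpose f)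

/-- The underlying scheme morphism of `f^D` is `Spec (transpose f)`. [cite: Tate1997FiniteFlatGroupSchemes, §(3.8) p. 145] -/
theorem cartierDualMap_left : (cartierDualMap f).left = Spec.map (CommRingCat.ofHom (DualAlg.transpose f).toRingHom) := rfl

/-- **HEAD — `f^D` is a homomorphism of group schemes** (for the group objects ★ `cartierDualGrpObj`): `Spec` of the bialgebra map
`DualAlg.transposeBialgHom f` (★ `isMonHom_specOverMapOfAlgHom`). [cite: Tate1997FiniteFlatGroupSchemes, §(3.8) p. 145] -/
theorem isMonHom_cartierDualMap [Module.Free R (Alg G₁)] [Module.Finite R (Alg G₁)] [Module.Free R (Alg G₂)] [Module.Finite R (Alg G₂)] :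
    letI := cartierDualGrpObj G₁
    letI := cartierDualGrpObj G₂
    IsMonHom (cartierDualMap f) :=
  isMonHom_specOverMapOfAlgHom R (DualAlg.transposeBialgHom f)

/-- **Points**: a `T`-point `x` of `G₂^D` (coordinates `coord x : Γ(G₂)^* → Γ(T)`) goes to the point of `G₁^D` with coordinates
`coord x ∘ transpose f` — the character is pulled back along `f` (★ `coord_comp_specOverMapOfAlgHom`). [cite: Tate1997FiniteFlatGroupSchemes, §(3.8) p. 145] -/
theorem coord_comp_cartierDualMap {T : SchemeOver R} (x : T ⟶ cartierDual G₂) :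
    coord (x ≫ cartierDualMap f) = (coord x).comp (DualAlg.transpose f) :=
  coord_comp_specOverMapOfAlgHom x (DualAlg.transpose f)

omit [IsMonHom f] in
/-- **`(𝟙 G)^D = 𝟙 (G^D)`.** [cite: Tate1997FiniteFlatGroupSchemes, §(3.8) p. 145] -/
theorem cartierDualMap_id : cartierDualMap (𝟙 G₁) = 𝟙 (cartierDual G₁) := by
  apply Over.OverMorphism.ext
  rw [cartierDualMap_left, DualAlg.transpose_id, Over.id_left]
  exact Spec.map_id _

/-- **`(f ≫ g)^D = g^D ≫ f^D`** — the Cartier dual is a contravariant functor. [cite: Tate1997FiniteFlatGroupSchemes, §(3.8) p. 145] -/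
theorem cartierDualMap_comp (g : G₂ ⟶ G₃) [IsMonHom g] : cartierDualMap (f ≫ g) = cartierDualMap g ≫ cartierDualMap f := by
  apply Over.OverMorphism.ext
  rw [Over.comp_left, cartierDualMap_left, cartierDualMap_left, cartierDualMap_left, DualAlg.transpose_comp, ← Spec.map_comp]
  rfl

end Map

end AffineGroupScheme

end Literature.AlgebraicGeometry.GroupSchemes

end
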